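import Summits.Ventures.HSemireg.WedgeHankelRecurrenceGaussChebyshevCLevelSetRootsReal

/-!
# Venture HSemireg — **THE CHEBYSHEV POLYNOMIALS OF THE THIRD AND FOURTH KINDS `V_k = U_k − U_{k−1}`, `W_k = U_k + U_{k−1}`: degree `k`, leading coefficient `2^k`, and their REAL ROOTS
# `W_k.roots = {cos(2jπ∕(2k+1)) : 1 ≤ j ≤ k}`, `V_k.roots = {cos((2j+1)π∕(2k+1)) : j < k}`** (all simple), root tests and the real factorisations `W_k = 2^k ∏ (X − cos(2jπ∕(2k+1)))`,
# `V_k = 2^k ∏ (X − cos((2j+1)π∕(2k+1)))`; dilation `W_k(x) = (S_k + S_{k−1})(2x)`, `V_k(x) = (S_k − S_{k−1})(2x)`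

HONEST FRAMING. Part of the Lean index of the computation cell `pub-hsemireg` (seat p10 gen 49, Sunday typer «UNIFORM-IN-n»).  Real polynomial algebra and trigonometry only (Mathlib
`Polynomial.Chebyshev.T ∕ U ∕ S`, `Polynomial.roots`, `Real.cos`); no variety, no cohomology theory, no sheaf, no Ext group and no semiregularity map is constructed here; nothing here says that
HC / HC_CM / HC_AV holds; no Literature fact (unproved `Prop`) is declared or used.  Custodian versions as in `WedgeHankelSiegelIdeal` (1/3).
SOURCES (cited).  J. C. Mason, D. C. Handscomb, *Chebyshev Polynomials* (2003), §1.2.3 eqs. (1.18)–(1.20) (`V_n`, `W_n`), §2.2 (zeros: `x = cos((k−½)π∕(n+½))` for `V_n`, `x = cos(kπ∕(n+½))` for `W_n`);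
W. Gautschi, *Orthogonal Polynomials: Computation and Approximation* (2004), Ex. 1.x (Gauss–Radau–Chebyshev nodes); T. J. Rivlin, *The Chebyshev Polynomials* (1974), §1.2.
PROOF TYPED HERE.  At `x = cos θ`, `θ = 2jπ∕(2k+1)` (resp. `(2j+1)π∕(2k+1)`), Mathlib `T_real_cos` gives `T_{2k+1}(x) = 1` (resp. `−1`); `0 < θ < π` gives `x ≠ ±1` (N501
`cos_ne_one_and_ne_neg_one_of_pos_of_lt_pi`), so the N478 identities `T_{2k+1} − 1 = (X − 1)W_k²`, `T_{2k+1} + 1 = (X + 1)V_k²` force `W_k(x) = 0` (resp. `V_k(x) = 0`); distinctness from N501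
(`Multiset.Nodup.of_map` along `x ↦ 2x`); degree `k` from Mathlib `degree_U_natCast`; Mathlib `roots_eq_of_degree_eq_card`, `C_leadingCoeff_mul_prod_multiset_X_sub_C`.
DEDUP DISCLOSURE (`rg -n 'U_add_pred|U_sub_pred|third kind|fourth kind' Summits/Ventures/HSemireg`, `lean search`, 2026-09-04): N478 has the identities and the root SET readings
`chebyshevT_two_mul_add_one_eval_eq_one_iff ∕ _eq_neg_one_iff` («`x = 1 ∨ W_k(x) = 0`»); no degree ∕ root multiset ∕ factorisation of `V_k`, `W_k` is in the tree or in Mathlib; 0 hits for the 12 names below.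

WHAT IS IN THE TREE.  N478 `chebyshevT_two_mul_add_one_sub_one ∕ _add_one`; N501 (roots of `S_k ± S_{k−1}`, `cos θ ≠ ±1`); Mathlib `T_real_cos`, `degree_U_natCast`, `leadingCoeff_U_natCast`, `S_comp_two_mul_X`.
THIS FILE (namespace `Summit.Ventures.HSemireg.Wedge.HankelOuter` continued; CHAINED on N502; 0 definitions):
* §1268 `chebyshevU_add_pred_eq_comp`, `chebyshevU_sub_pred_eq_comp`, `chebyshevU_add_pred_degree_leadingCoeff`, `chebyshevU_sub_pred_degree_leadingCoeff`,
  **`chebyshevU_add_pred_roots_real`**, `chebyshevU_add_pred_eval_eq_zero_iff_real`, `chebyshevU_add_pred_eq_prod_real`,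
  **`chebyshevU_sub_pred_roots_real`**, `chebyshevU_sub_pred_eval_eq_zero_iff_real`, `chebyshevU_sub_pred_eq_prod_real`, `chebyshevW_roots_real_nodup`, `chebyshevV_roots_real_nodup`.
CAVEATS.  `k ∈ ℕ`; degree statements in a domain with `2 ≠ 0`.  No `V ∕ W` definitions are introduced (the sums `U_k ± U_{k−1}` are spelled out).  Nothing Ext-side.  New names only.
-/

open Module Polynomial Real
open scoped Matrix Polynomial

namespace Summit.Ventures.HSemireg.Wedge.HankelOuter

/-! ## §1268. `V_k = U_k − U_{k−1}`, `W_k = U_k + U_{k−1}`: degree and real roots -/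

/-- Dilation: `(S_k + S_{k−1})(2x) = U_k + U_{k−1} = W_k`. [Mathlib `S_comp_two_mul_X`; this file, §1268] -/
theorem chebyshevU_add_pred_eq_comp {R : Type*} [CommRing R] (k : ℤ) :
    (Polynomial.Chebyshev.S R k + Polynomial.Chebyshev.S R (k - 1)).comp (2 * Polynomial.X) = Polynomial.Chebyshev.U R k + Polynomial.Chebyshev.U R (k - 1) := by
  rw [add_comp, Polynomial.Chebyshev.S_comp_two_mul_X, Polynomial.Chebyshev.S_comp_two_mul_X]

/-- Dilation: `(S_k − S_{k−1})(2x) = U_k − U_{k−1} = V_k`. [Mathlib `S_comp_two_mul_X`; this file, §1268] -/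
theorem chebyshevU_sub_pred_eq_comp {R : Type*} [CommRing R] (k : ℤ) :
    (Polynomial.Chebyshev.S R k - Polynomial.Chebyshev.S R (k - 1)).comp (2 * Polynomial.X) = Polynomial.Chebyshev.U R k - Polynomial.Chebyshev.U R (k - 1) := by
  rw [sub_comp, Polynomial.Chebyshev.S_comp_two_mul_X, Polynomial.Chebyshev.S_comp_two_mul_X]

/-- `W_k = U_k + U_{k−1}` has degree `k` and leading coefficient `2^k` (domain, `2 ≠ 0`). [Mason–Handscomb (1.20); this file, §1268] -/
theorem chebyshevU_add_pred_degree_leadingCoeff {R : Type*} [CommRing R] [IsDomain R] [NeZero (2 : R)] (k : ℕ) :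
    (Polynomial.Chebyshev.U R (k : ℤ) + Polynomial.Chebyshev.U R ((k : ℤ) - 1)).degree = k ∧
      (Polynomial.Chebyshev.U R (k : ℤ) + Polynomial.Chebyshev.U R ((k : ℤ) - 1)).leadingCoeff = 2 ^ k := by
  rcases Nat.eq_zero_or_pos k with rfl | hk
  · simp only [Nat.cast_zero, Polynomial.Chebyshev.U_zero, zero_sub, Polynomial.Chebyshev.U_neg_one, add_zero, degree_one, pow_zero, leadingCoeff_one, and_self]
  obtain ⟨j, rfl⟩ := Nat.exists_eq_add_one_of_ne_zero hk.ne'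
  have hidx : ((j + 1 : ℕ) : ℤ) - 1 = (j : ℤ) := by push_cast; ring
  have hlt : (Polynomial.Chebyshev.U R (j : ℤ)).degree < (Polynomial.Chebyshev.U R ((j + 1 : ℕ) : ℤ)).degree := by
    rw [Polynomial.Chebyshev.degree_U_natCast, Polynomial.Chebyshev.degree_U_natCast]; exact_mod_cast Nat.lt_succ_self j
  rw [hidx, degree_add_eq_left_of_degree_lt hlt, leadingCoeff_add_of_degree_lt' hlt, Polynomial.Chebyshev.degree_U_natCast, Polynomial.Chebyshev.leadingCoeff_U_natCast]
  exact ⟨rfl, rfl⟩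

/-- `V_k = U_k − U_{k−1}` has degree `k` and leading coefficient `2^k` (domain, `2 ≠ 0`). [Mason–Handscomb (1.20); this file, §1268] -/
theorem chebyshevU_sub_pred_degree_leadingCoeff {R : Type*} [CommRing R] [IsDomain R] [NeZero (2 : R)] (k : ℕ) :
    (Polynomial.Chebyshev.U R (k : ℤ) - Polynomial.Chebyshev.U R ((k : ℤ) - 1)).degree = k ∧
      (Polynomial.Chebyshev.U R (k : ℤ) - Polynomial.Chebyshev.U R ((k : ℤ) - 1)).leadingCoeff = 2 ^ k := by
  rcases Nat.eq_zero_or_pos k with rfl | hk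
  · simp only [Nat.cast_zero, Polynomial.Chebyshev.U_zero, zero_sub, Polynomial.Chebyshev.U_neg_one, sub_zero, degree_one, pow_zero, leadingCoeff_one, and_self]
  obtain ⟨j, rfl⟩ := Nat.exists_eq_add_one_of_ne_zero hk.ne'
  have hidx : ((j + 1 : ℕ) : ℤ) - 1 = (j : ℤ) := by push_cast; ring
  have hlt : (Polynomial.Chebyshev.U R (j : ℤ)).degree < (Polynomial.Chebyshev.U R ((j + 1 : ℕ) : ℤ)).degree := by
    rw [Polynomial.Chebyshev.degree_U_natCast, Polynomial.Chebyshev.degree_U_natCast]; exact_mod_cast Nat.lt_succ_self j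
  rw [hidx, degree_sub_eq_left_of_degree_lt hlt, leadingCoeff_sub_of_degree_lt hlt, Polynomial.Chebyshev.degree_U_natCast, Polynomial.Chebyshev.leadingCoeff_U_natCast]
  exact ⟨rfl, rfl⟩

/-- The points `cos(2(j+1)π∕(2k+1))`, `j < k`, are pairwise distinct. [this file, §1268] -/
theorem chebyshevW_roots_real_nodup (k : ℕ) : ((Multiset.range k).map fun j : ℕ => cos (2 * (j + 1) * π / (2 * k + 1))).Nodup := by
  have h := chebyshevS_add_pred_roots_real_nodup k
  have h2 : ((Multiset.range k).map fun j : ℕ => cos (2 * (j + 1) * π / (2 * k + 1))).map (fun x : ℝ => 2 * x) =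
      (Multiset.range k).map fun j : ℕ => 2 * cos (2 * (j + 1) * π / (2 * k + 1)) := by rw [Multiset.map_map]; rfl
  rw [← h2] at h
  exact h.of_map _

/-- The points `cos((2j+1)π∕(2k+1))`, `j < k`, are pairwise distinct. [this file, §1268] -/
theorem chebyshevV_roots_real_nodup (k : ℕ) : ((Multiset.range k).map fun j : ℕ => cos ((2 * j + 1) * π / (2 * k + 1))).Nodup := by
  have h := chebyshevS_sub_pred_roots_real_nodup k
  have h2 : ((Multiset.range k).map fun j : ℕ => cos ((2 * j + 1) * π / (2 * k + 1))).map (fun x : ℝ => 2 * x) =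
      (Multiset.range k).map fun j : ℕ => 2 * cos ((2 * j + 1) * π / (2 * k + 1)) := by rw [Multiset.map_map]; rfl
  rw [← h2] at h
  exact h.of_map _

/-- **Zeros of the fourth-kind polynomial: `W_k.roots = (U_k + U_{k−1}).roots = {cos(2(j+1)π∕(2k+1)) : j < k}` over `ℝ`** (all simple). [Mason–Handscomb §2.2; this file, §1268] -/
theorem chebyshevU_add_pred_roots_real (k : ℕ) :
    (Polynomial.Chebyshev.U ℝ (k : ℤ) + Polynomial.Chebyshev.U ℝ ((k : ℤ) - 1)).roots = (Multiset.range k).map fun j : ℕ => cos (2 * (j + 1) * π / (2 * k + 1)) := by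
  classical
  have hnd := chebyshevW_roots_real_nodup k
  have hfin : ((Multiset.range k).map fun j : ℕ => cos (2 * (j + 1) * π / (2 * k + 1))) =
      (((Multiset.range k).map fun j : ℕ => cos (2 * (j + 1) * π / (2 * k + 1))).toFinset).val := by
    rw [Multiset.toFinset_val, Multiset.dedup_eq_self.mpr hnd]
  rw [hfin]
  refine roots_eq_of_degree_eq_card (fun x hx => ?_) ?_
  · obtain ⟨j, hj, rfl⟩ := Multiset.mem_map.mp (Multiset.mem_toFinset.mp hx)
    have hj : j < k := Multiset.mem_range.mp hj
    set θ : ℝ := 2 * ((j : ℝ) + 1) * π / (2 * k + 1) with hθ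
    have hθpos : 0 < θ := by positivity
    have hθlt : θ < π := by
      rw [hθ, div_lt_iff₀ (by positivity)]
      have : (j : ℝ) + 1 ≤ k := by exact_mod_cast Nat.lt_iff_add_one_le.mp hj
      nlinarith [pi_pos]
    have hT : (Polynomial.Chebyshev.T ℝ (2 * (k : ℤ) + 1)).eval (cos θ) = 1 := by
      rw [Polynomial.Chebyshev.T_real_cos, show (((2 * (k : ℤ) + 1 : ℤ)) : ℝ) * θ = ((j + 1 : ℕ) : ℝ) * (2 * π) by rw [hθ]; push_cast; field_simp, cos_nat_mul_two_pi]
    have hfac := congrArg (Polynomial.eval (cos θ)) (chebyshevT_two_mul_add_one_sub_one (R := ℝ) (k : ℤ))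
    simp only [eval_sub, eval_mul, eval_pow, eval_X, eval_one, hT, sub_self] at hfac
    have hne : cos θ - 1 ≠ 0 := fun h => (cos_ne_one_and_ne_neg_one_of_pos_of_lt_pi hθpos hθlt).1 (by linarith)
    exact eq_zero_of_pow_eq_zero ((mul_eq_zero.mp hfac.symm).resolve_left hne)
  · rw [Multiset.card_toFinset, Multiset.dedup_eq_self.mpr hnd, Multiset.card_map, Multiset.card_range]
    exact (chebyshevU_add_pred_degree_leadingCoeff (R := ℝ) k).1.symm

/-- **Root test: `W_k(x) = (U_k + U_{k−1})(x) = 0 ⇔ x = cos(2(j+1)π∕(2k+1))` for some `j < k`** (`x ∈ ℝ`). [Mason–Handscomb §2.2; this file, §1268] -/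
theorem chebyshevU_add_pred_eval_eq_zero_iff_real (k : ℕ) (x : ℝ) :
    (Polynomial.Chebyshev.U ℝ (k : ℤ) + Polynomial.Chebyshev.U ℝ ((k : ℤ) - 1)).eval x = 0 ↔ ∃ j < k, x = cos (2 * (j + 1) * π / (2 * k + 1)) := by
  have hne : Polynomial.Chebyshev.U ℝ (k : ℤ) + Polynomial.Chebyshev.U ℝ ((k : ℤ) - 1) ≠ 0 := by
    rw [← degree_ne_bot, (chebyshevU_add_pred_degree_leadingCoeff (R := ℝ) k).1]; exact WithBot.natCast_ne_bot k
  rw [← Polynomial.IsRoot.def, ← mem_roots hne, chebyshevU_add_pred_roots_real, Multiset.mem_map]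
  constructor
  · rintro ⟨j, hj, rfl⟩; exact ⟨j, Multiset.mem_range.mp hj, rfl⟩
  · rintro ⟨j, hj, rfl⟩; exact ⟨j, Multiset.mem_range.mpr hj, rfl⟩

/-- **`W_k = U_k + U_{k−1} = 2^k ∏_{j<k} (X − cos(2(j+1)π∕(2k+1)))` over `ℝ`.** [Mason–Handscomb §2.2; this file, §1268] -/
theorem chebyshevU_add_pred_eq_prod_real (k : ℕ) :
    Polynomial.Chebyshev.U ℝ (k : ℤ) + Polynomial.Chebyshev.U ℝ ((k : ℤ) - 1) =
      Polynomial.C ((2 : ℝ) ^ k) * ∏ j ∈ Finset.range k, (Polynomial.X - Polynomial.C (cos (2 * (j + 1) * π / (2 * k + 1)))) := by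
  obtain ⟨hdeg, hlc⟩ := chebyshevU_add_pred_degree_leadingCoeff (R := ℝ) k
  have hnat : (Polynomial.Chebyshev.U ℝ (k : ℤ) + Polynomial.Chebyshev.U ℝ ((k : ℤ) - 1)).natDegree = k := natDegree_eq_of_degree_eq_some hdeg
  have h := C_leadingCoeff_mul_prod_multiset_X_sub_C (p := Polynomial.Chebyshev.U ℝ (k : ℤ) + Polynomial.Chebyshev.U ℝ ((k : ℤ) - 1))
    (by rw [chebyshevU_add_pred_roots_real, Multiset.card_map, Multiset.card_range, hnat])
  rw [← h, hlc, chebyshevU_add_pred_roots_real, Multiset.map_map, Finset.prod_eq_multiset_prod, Finset.range_val]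
  rfl

/-- **Zeros of the third-kind polynomial: `V_k.roots = (U_k − U_{k−1}).roots = {cos((2j+1)π∕(2k+1)) : j < k}` over `ℝ`** (all simple). [Mason–Handscomb §2.2; this file, §1268] -/
theorem chebyshevU_sub_pred_roots_real (k : ℕ) :
    (Polynomial.Chebyshev.U ℝ (k : ℤ) - Polynomial.Chebyshev.U ℝ ((k : ℤ) - 1)).roots = (Multiset.range k).map fun j : ℕ => cos ((2 * j + 1) * π / (2 * k + 1)) := by
  classical
  have hnd := chebyshevV_roots_real_nodup k
  have hfin : ((Multiset.range k).map fun j : ℕ => cos ((2 * j + 1) * π / (2 * k + 1))) =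
      (((Multiset.range k).map fun j : ℕ => cos ((2 * j + 1) * π / (2 * k + 1))).toFinset).val := by
    rw [Multiset.toFinset_val, Multiset.dedup_eq_self.mpr hnd]
  rw [hfin]
  refine roots_eq_of_degree_eq_card (fun x hx => ?_) ?_
  · obtain ⟨j, hj, rfl⟩ := Multiset.mem_map.mp (Multiset.mem_toFinset.mp hx)
    have hj : j < k := Multiset.mem_range.mp hj
    set θ : ℝ := (2 * (j : ℝ) + 1) * π / (2 * k + 1) with hθ
    have hθpos : 0 < θ := by positivity
    have hθlt : θ < π := by
      rw [hθ, div_lt_iff₀ (by positivity)]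
      have : (j : ℝ) + 1 ≤ k := by exact_mod_cast Nat.lt_iff_add_one_le.mp hj
      nlinarith [pi_pos]
    have hT : (Polynomial.Chebyshev.T ℝ (2 * (k : ℤ) + 1)).eval (cos θ) = -1 := by
      rw [Polynomial.Chebyshev.T_real_cos, show (((2 * (k : ℤ) + 1 : ℤ)) : ℝ) * θ = ((2 * j + 1 : ℕ) : ℝ) * π by rw [hθ]; push_cast; field_simp, cos_nat_mul_pi, pow_succ, pow_mul,
        neg_one_sq, one_pow, one_mul]
    have hfac := congrArg (Polynomial.eval (cos θ)) (chebyshevT_two_mul_add_one_add_one (R := ℝ) (k : ℤ))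
    simp only [eval_add, eval_mul, eval_pow, eval_X, eval_one, hT, neg_add_cancel] at hfac
    have hne : cos θ + 1 ≠ 0 := fun h => (cos_ne_one_and_ne_neg_one_of_pos_of_lt_pi hθpos hθlt).2 (by linarith)
    exact eq_zero_of_pow_eq_zero ((mul_eq_zero.mp hfac.symm).resolve_left hne)
  · rw [Multiset.card_toFinset, Multiset.dedup_eq_self.mpr hnd, Multiset.card_map, Multiset.card_range]
    exact (chebyshevU_sub_pred_degree_leadingCoeff (R := ℝ) k).1.symm

/-- **Root test: `V_k(x) = (U_k − U_{k−1})(x) = 0 ⇔ x = cos((2j+1)π∕(2k+1))` for some `j < k`** (`x ∈ ℝ`). [Mason–Handscomb §2.2; this file, §1268] -/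
theorem chebyshevU_sub_pred_eval_eq_zero_iff_real (k : ℕ) (x : ℝ) :
    (Polynomial.Chebyshev.U ℝ (k : ℤ) - Polynomial.Chebyshev.U ℝ ((k : ℤ) - 1)).eval x = 0 ↔ ∃ j < k, x = cos ((2 * j + 1) * π / (2 * k + 1)) := by
  have hne : Polynomial.Chebyshev.U ℝ (k : ℤ) - Polynomial.Chebyshev.U ℝ ((k : ℤ) - 1) ≠ 0 := by
    rw [← degree_ne_bot, (chebyshevU_sub_pred_degree_leadingCoeff (R := ℝ) k).1]; exact WithBot.natCast_ne_bot k
  rw [← Polynomial.IsRoot.def, ← mem_roots hne, chebyshevU_sub_pred_roots_real, Multiset.mem_map]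
  constructor
  · rintro ⟨j, hj, rfl⟩; exact ⟨j, Multiset.mem_range.mp hj, rfl⟩
  · rintro ⟨j, hj, rfl⟩; exact ⟨j, Multiset.mem_range.mpr hj, rfl⟩

/-- **`V_k = U_k − U_{k−1} = 2^k ∏_{j<k} (X − cos((2j+1)π∕(2k+1)))` over `ℝ`.** [Mason–Handscomb §2.2; this file, §1268] -/
theorem chebyshevU_sub_pred_eq_prod_real (k : ℕ) :
    Polynomial.Chebyshev.U ℝ (k : ℤ) - Polynomial.Chebyshev.U ℝ ((k : ℤ) - 1) =
      Polynomial.C ((2 : ℝ) ^ k) * ∏ j ∈ Finset.range k, (Polynomial.X - Polynomial.C (cos ((2 * j + 1) * π / (2 * k + 1)))) := by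
  obtain ⟨hdeg, hlc⟩ := chebyshevU_sub_pred_degree_leadingCoeff (R := ℝ) k
  have hnat : (Polynomial.Chebyshev.U ℝ (k : ℤ) - Polynomial.Chebyshev.U ℝ ((k : ℤ) - 1)).natDegree = k := natDegree_eq_of_degree_eq_some hdeg
  have h := C_leadingCoeff_mul_prod_multiset_X_sub_C (p := Polynomial.Chebyshev.U ℝ (k : ℤ) - Polynomial.Chebyshev.U ℝ ((k : ℤ) - 1))
    (by rw [chebyshevU_sub_pred_roots_real, Multiset.card_map, Multiset.card_range, hnat])
  rw [← h, hlc, chebyshevU_sub_pred_roots_real, Multiset.map_map, Finset.prod_eq_multiset_prod, Finset.range_val]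
  rfl

end Summit.Ventures.HSemireg.Wedge.HankelOuter
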